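import Summits.QuantumFields.BalabanUV.Beta.D1BFx.ChartDefectRowMcolMass
import Summits.QuantumFields.BalabanUV.Beta.SymCorrectorFaceWeight
import Summits.QuantumFields.BalabanUV.Beta.SymCorrectorMixedSiteWmix
import Summits.QuantumFields.BalabanUV.Beta.D1BFx.PackedColumnEnvelope
import Summits.QuantumFields.BalabanUV.Beta.BondIndicatorGaugeL1
import Summits.QuantumFields.BalabanUV.Beta.D1BFx.DressedMixVertexSplit
import Summits.QuantumFields.BalabanUV.Beta.D1BFx.ChartDefectResolvent
import Summits.QuantumFields.BalabanUV.Beta.BubbleParity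
import Summits.QuantumFields.BalabanUV.Beta.SymTablesAn1FirstOrder
import Summits.QuantumFields.BalabanUV.Beta.D1BFx.FaceWeightMasses

/-!
# `BalabanUV.Beta.D1BFx.ChartDefectRowMsMass` — road «BF-x», binder row D1, PART 24-hyb HEAD (`ChartDefectHead` v1.1's rows), **THE FACE-MIXED ROW (ms) IN MASS CURRENCY**
# (leaf-03 g33, TT28; the (ms) sibling of TT27b `ChartDefectRowMcolMass`): the HEAD's (ms) word — LITERALLY `z ↦ ½·tadpole G₀ (WMs[G₀] a 0 e z)` — is a (5.10)-kernel in the coarse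
# variable with a CLOSED constant and an `n`-FREE rate, modulo the DISPLAYED leg letter `Bdd G₀ S` and multiplier envelope `hΦ` (gan24-leaf-05 g61∕g62's sockets, verbatim):
# `Decay510 (…) (¼·S·(2·GΘ(n)·M_H(n) + 2·GΘ(n)·M_H(n))) (n·σ)`, `GΘ(n) = C_G(n)·(2·(4·(n·4)))·e^{r_G(|ρ_c|₁ + 4n)}` the face generator `Θ′`'s SUP through the leg — the dressed column's
# envelope `C_G(n) = (n⁴)⁻¹·C₄(1 + 8(1 + e^{κ′}))e^{κ′}` (gan24-leaf-05 g53 `PackedColumnEnvelope.abs_colH_G₀_road_le`) times the face weight's BLOCK MASS `2·faceWtSum (ctrOff 4 n) n ≤ 2·16n`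
# (TT25 `SymCorrectorFaceWeight.abs_blockSymbol_le_mass_of_col` + gan24-leaf-05 g58 `BondIndicatorGaugeL1.sum_box_abs_zetaS_delta1_le`) —, `M_H(n)` TT27b's σ-weighted mass of
# `V_H = vertexOfM K₀ n (symHessFFAt ρ_c n)` (`= vertexOfM G₀ n (…)` — leaf-01's `DressedMixVertexSplit.vertexOfM_coDress_eq`).

HOW.  Under the road's tadpole the raw (ms) word is `−½·` leaf-01's bracket `Wmix(Θ′; V_H)` (TT26 `SymCorrectorMixedSiteWmix.tadpole_WMs_eq_neg_Wmix` = TT21 + a sign, its sockets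
discharged at the record by d1-p2's `ChartDefectResolvent.spr_G0bm_ctr`, an2's `BubbleParity.trK_coDressKBmAt_KInvStep`, an1's `vertexFamily_symHessFFAt` ∕ `trK_symHessFFAt` — exactly the
OWNER's `ChartDefectTwoPinsRest` (ii) dischargers); the bracket is a DIAGONAL kernel against a vertex family, priced by TT27a `DiagBracketWordMass.decay510_bracketWord_of_wmass`
(diagonal in SUP from its coarse point, vertex in σ-weighted `ℓ¹` mass at its coarse point, `δ ≤ σ`; no `Zl` volume at the trace; rate `n·σ`).
CONTENT (`d = 3`, `(n) [NeZero n]`, `1 ≤ n`; the face weight's block masses — `faceWtSum_ctrOff_le` etc. — are TT30 `D1BFx/FaceWeightMasses`, BY NAME).  §1 `abs_faceSymbol_G₀_legSite_le` (ANY scalar `ξ` — the OWNER's WANTED O-3: `Θ′` at `ξ = 2`, `Λf` at `ξ = n⁴∕2`), `abs_faceGen_G₀_legSite_le` (the `hg` socket: `|Θ′-symbol at (x, b)| ≤ GΘ(n)·e^{−r_G|x − n•y|₁}`, `r_G = κ₁₆₃(4)∕4∕(4n)`).  §2 **`decay510_row_ms_bracket_mass_of_wmass`** (ANY bounded leg `G`,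 any
scalar `c`, the vertex family's σ-weighted mass `≤ MV` a BINDER `hV` — TT27a's socket exposed at the record, so that EITHER mass letter plugs by term: TT27b's `wmass_vertexOfM_K₀_symHessFFAt_le`
(g61's `Zl` route, `M_H(n)`) or gan24-leaf-05 g63's «H-TABLE-MASS» `SymHessTablePairMass` letter (no `Zl²`; their junction probe rc 0)).  §3 **`decay510_row_ms_mass_of_wmass`** ∕ **`row_ms_mass_of_wmass`**
(the HEAD's literal at its own leg `G₀`, scalar `¼`, binder `hV`) and the `Zl`-route INSTANCES **`decay510_row_ms_mass`**, **`row_ms_mass`** (the binder shapes `hAms ∕ hBms`: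
`(∀ a e, AbsMoment₂ …) ∧ |secondMoment … μ ν| ≤ C_ms·Σ'|x|₁²e^{−(n·σ)|x|₁}`, `MV := M_H(n)`).  LOCATED COUNT (zero weight on rulings): `GΘ ≍ n⁻⁴·n = n⁻³`, `M_H ≍ n²` ⇒ NET `C_ms ≍ S·n⁻¹` (g63's letter: `MV ≍ n⁻⁶·CΦ` ⇒ `≍ S·n⁻⁹·CΦ`) with an
`n`-free rate — m-uniform AS FAR AS THIS FILE READS; the `n`-laws of `S` and `CΦ` NOT claimed.  NOT HERE: the (lamf) row (N-1 PS: the dressed column's INTERIOR envelope, Q-1).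

HONEST DEPENDENCY (cell records, verbatim): «continuum YM on T⁴ ⇐ BetaPertH ∧ nine spine estimates (0/9 proved); BetaPertH ⇐ (D1) ∧ (D4) ∧
CAP+tail; G-an2-4 gates asym, D1 and NE2/3/4.»  HONEST FRAMING (cell contract, verbatim): «discharging `BetaPertH` makes Bałaban's UV stability
UNCONDITIONAL — a real constructive-QFT result; it is NOT the continuum limit and NOT the Clay problem.»  THIS MODULE is [folklore] `ℓ¹` ∕ (1.22) read-out bookkeeping BY NAME over
landed objects; ONE displayed row of the HEAD priced MODULO two displayed letters — per-word INTERMEDIATE (an2 R-D1-g45-4 (3)), not the HEAD, not the END; no definition,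
no `def … : Prop`, nothing cited, 0 sorry.  0∕4 row-D1 binders (hW ∕ hR ∕ D1Tel ∕ D1Rep); (J1) ONE OPEN ROW (eight displayed rows); (K) NOT closed; NOT D1, NEVER «G-an2-4 closed»,
NOT `BetaPertH`, NOT continuum, NOT Clay.

ABSOLUTE RULE (cell charter, verbatim): «No internally-minted statement may enter as a cited fact. Every hypothesis is either kernel-proved in
this package or a verbatim quotation of a PUBLISHED theorem with page reference. The manuscript(s) under audit are NOT citable for their own
disputed steps — they are the thing under adjudication; programme-internal (2001/route/tribunal) claims are never citable.»

Unit `b2b-balaban-beta-d1-formalise-leaf-03` (gen 33), D1 formalisation swarm LEAF PROVER 03, road «BF-x»; 2026-08-23.  No existing file touched.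
-/

noncomputable section

namespace Summit.QuantumFields.BalabanUV.Beta.D1BFx.ChartDefectRowMsMass

open Finset
open scoped BigOperators
open Literature.MathematicalPhysics.QuantumFieldTheory
open Literature.MathematicalPhysics.QuantumFieldTheory.Balaban1983to89
open Literature.MathematicalPhysics.QuantumFieldTheory.Balaban1983to89.Beta
open B12Sec2to5 (l1 l1_nonneg Decay510 secondMoment_abs_le_of_decay510)
open DecimatedMomentSummable (AbsMoment₂ absMoment₂_of_decay510)
open B4ContourShift (supNorm)
open B5Hk163Strip (kappa163 kappa163_pos)
open B5Hk163Decay (MG163)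
open B4TorusKernel (periodConst)
open ExpKernelCalculus (Site MKer Zl VertexFamily comp tadpole l1_sub_triangle l1_sub_symm l1_natSmul)
open AveragingHessianKernels (ell)
open AffineAveraging (box toSite)
open AveragingContours (blk)
open AveragingContoursRooted (ctr ctrOff ctrOff_mem_box)
open KernelSpecInstance (wΦ)
open KernelWard (Bdd)
open KernelReflection (tadpole_smul)
open OneStepResolventKernel (Fib)
open OneStepKernelFamily (colH KInvStep)
open SecondOrderResponse (vertexOfM mixOfK)
open Summit.QuantumFields.BalabanUV.Beta.TameKernelCalculus (Spr trK)
open Summit.QuantumFields.BalabanUV.Beta.BorderedHessian (diagK sgnK)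
open Summit.QuantumFields.BalabanUV.Beta.AxialDressingRooted (coDressKBmAt)
open Summit.QuantumFields.BalabanUV.Beta.AveragingWardRootedStencils (legSite)
open Summit.QuantumFields.BalabanUV.Beta.CompositeCorrectorLocality (blockSitesF)
open Summit.QuantumFields.BalabanUV.Beta.CompositeCorrectorBordered (indR_eq_delta1)
open Summit.QuantumFields.BalabanUV.Beta.SymAveragingHessianCounts (symHessFFAt vertexFamily_symHessFFAt)
open Summit.QuantumFields.BalabanUV.Beta.SymTablesAn1FirstOrder (trK_symHessFFAt)
open Summit.QuantumFields.BalabanUV.Beta.BubbleParity (trK_coDressKBmAt_KInvStep)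
open Summit.QuantumFields.BalabanUV.Beta.SymCorrectorFace (faceWt faceWtSum)
open Summit.QuantumFields.BalabanUV.Beta.SymCorrectorFaceWeight (blockMass_smul_faceWt_eq abs_blockSymbol_le_mass_of_col)
open Summit.QuantumFields.BalabanUV.Beta.SymCorrectorMixedSiteWmix (tadpole_WMs_eq_neg_Wmix)
open Summit.QuantumFields.BalabanUV.Beta.BondIndicatorGaugeL1 (sum_box_abs_zetaS_delta1_le)
open Summit.QuantumFields.BalabanUV.Beta.D1BFx.PackedColumnEnvelope (abs_colH_G₀_road_le)
open Summit.QuantumFields.BalabanUV.Beta.D1BFx.DressedMixVertexSplit (vertexOfM_coDress_eq)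
open Summit.QuantumFields.BalabanUV.Beta.D1BFx.ChartDefectResolvent (spr_G0bm_ctr)
open Summit.QuantumFields.BalabanUV.Beta.D1BFx.DiagBracketWordMass (decay510_bracketWord_of_wmass)
open Summit.QuantumFields.BalabanUV.Beta.D1BFx.ChartDefectRowMcolMass (wmass_vertexOfM_K₀_symHessFFAt_le)
open Summit.QuantumFields.BalabanUV.Beta.D1BFx.FaceWeightMasses (faceWtSum_ctrOff_le)

variable {d : ℕ}

/-! ## §1 The face generator's symbol through the leg -/

section Record

variable (n : ℕ) [NeZero n]

/-- [folklore] **THE FACE SYMBOL OF `G₀` AT ANY SCALAR `ξ`, THROUGH THE LEG, ENVELOPED FROM THE COARSE POINT** (`1 ≤ n`; the OWNER d1-p2 g25's WANTED O-3, W-g25-8 (c)):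
`|Σ_α Σ_{x′ ∈ blockSitesF n (blk n (legSite ρ_c x b))} colH G₀ n μ y α x′·(ξ·faceWt (ctrOff 4 n) n α x′)| ≤ (C_G(n)·(|ξ|·(4·(n·4)))·e^{r_G(|ρ_c|₁ + 4n)})·e^{−r_G|x − n•y|₁}`,
`r_G = κ₁₆₃(4)∕4∕(4n)`, `C_G(n) = (n⁴)⁻¹·C₄(1 + 8(1 + e^{κ′}))e^{κ′}` — TT25 `abs_blockSymbol_le_mass_of_col` with `hcol :=` gan24-leaf-05 g53's dressed-column envelope
`PackedColumnEnvelope.abs_colH_G₀_road_le` (`n = m + 1`, `ctr = toSite ctrOff` by `rfl`) and `hc :=` the face weight's block mass `|ξ|·faceWtSum ≤ |ξ|·(4·(n·4))` (§1 at `d = 3`).  At `ξ := 2`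
this is `Θ′[G₀]` (rows (ms)); at `ξ := n⁴∕2` (and a sign, `abs_neg`) it is the face gauge generator `Λf[G₀]` of row (lamf) — located count `≍ n⁻⁴·|ξ|·n`. -/
theorem abs_faceSymbol_G₀_legSite_le (hn : 1 ≤ n) (ξ : ℝ) (μ : Fin (3 + 1)) (y x : Site 4) (b : Fib 3) :
    |∑ α : Fin (3 + 1), ∑ x' ∈ blockSitesF n (blk n (legSite (ctr 4 n) x b)),
        colH (coDressKBmAt (ctr 4 n) n (KInvStep (d := 3) n 0)) n μ y α x' * (ξ * faceWt (ctrOff 4 n) n α x')|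
      ≤ (((((n : ℕ) : ℝ) ^ 4)⁻¹ * ((MG163 4 * periodConst (kappa163 4) 3) * (1 + 8 * (1 + Real.exp (kappa163 4 / 4))) * Real.exp (kappa163 4 / 4)))
          * (|ξ| * ((((3 : ℕ) : ℝ) + 1) * ((n : ℝ) * (((3 : ℕ) : ℝ) + 1))))
          * Real.exp (kappa163 4 / 4 / (4 * ((n : ℕ) : ℝ)) * (l1 (ctr 4 n) + (((3 + 1 : ℕ) : ℝ) * n))))
        * Real.exp (-(kappa163 4 / 4 / (4 * ((n : ℕ) : ℝ))) * l1 (x - (n : ℤ) • y)) := by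
  have hn0 : 0 < n := hn
  -- g53's envelope of the dressed column at the centred root (`n = m + 1`, `ctr = toSite ctrOff` by `rfl`)
  obtain ⟨m, rfl⟩ := Nat.exists_eq_succ_of_ne_zero (NeZero.ne n)
  have hcol : ∀ (α : Fin (3 + 1)) (u : Site 4),
      |colH (coDressKBmAt (ctr 4 (m + 1)) (m + 1) (KInvStep (d := 3) (m + 1) 0)) (m + 1) μ y α u|
        ≤ ((((m + 1 : ℕ) : ℝ) ^ 4)⁻¹ * ((MG163 4 * periodConst (kappa163 4) 3) * (1 + 8 * (1 + Real.exp (kappa163 4 / 4))) * Real.exp (kappa163 4 / 4)))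
          * Real.exp (-(kappa163 4 / 4 / (4 * ((m + 1 : ℕ) : ℝ))) * l1 (u - ((m + 1 : ℕ) : ℤ) • y)) :=
    fun α u => abs_colH_G₀_road_le m (ctrOff_mem_box hn) μ y α u
  have hC : 0 ≤ (((m + 1 : ℕ) : ℝ) ^ 4)⁻¹ * ((MG163 4 * periodConst (kappa163 4) 3) * (1 + 8 * (1 + Real.exp (kappa163 4 / 4))) * Real.exp (kappa163 4 / 4)) := by
    have h := (abs_nonneg _).trans (hcol 0 0)
    exact (mul_nonneg_iff_of_pos_right (Real.exp_pos _)).1 h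
  have hδ : 0 ≤ kappa163 4 / 4 / (4 * ((m + 1 : ℕ) : ℝ)) := by have := kappa163_pos 4; positivity
  -- the face weight's block mass at the centred root, at scalar `ξ`
  have hc : ∀ Y : Site 4, ∑ α : Fin (3 + 1), ∑ x' ∈ blockSitesF (m + 1) Y, |ξ * faceWt (ctrOff 4 (m + 1)) (m + 1) α x'|
      ≤ |ξ| * ((((3 : ℕ) : ℝ) + 1) * (((m + 1 : ℕ) : ℝ) * (((3 : ℕ) : ℝ) + 1))) := by
    intro Y
    rw [blockMass_smul_faceWt_eq hn0 (ctrOff 4 (m + 1)) ξ Y]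
    exact mul_le_mul_of_nonneg_left (faceWtSum_ctrOff_le (d := 3) hn) (abs_nonneg ξ)
  exact abs_blockSymbol_le_mass_of_col hn0 hC hδ hcol (ctr 4 (m + 1)) hc x b

/-- [folklore] **THE FACE GENERATOR `Θ′[G₀]`'s SYMBOL (`ξ = 2`) THROUGH THE LEG** — `abs_faceSymbol_G₀_legSite_le` at `ξ := 2` (`|2| = 2`); the `hg` socket of TT27a for row (ms). -/
theorem abs_faceGen_G₀_legSite_le (hn : 1 ≤ n) (μ : Fin (3 + 1)) (y x : Site 4) (b : Fib 3) :
    |∑ α : Fin (3 + 1), ∑ x' ∈ blockSitesF n (blk n (legSite (ctr 4 n) x b)),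
        colH (coDressKBmAt (ctr 4 n) n (KInvStep (d := 3) n 0)) n μ y α x' * (2 * faceWt (ctrOff 4 n) n α x')|
      ≤ (((((n : ℕ) : ℝ) ^ 4)⁻¹ * ((MG163 4 * periodConst (kappa163 4) 3) * (1 + 8 * (1 + Real.exp (kappa163 4 / 4))) * Real.exp (kappa163 4 / 4)))
          * (2 * ((((3 : ℕ) : ℝ) + 1) * ((n : ℝ) * (((3 : ℕ) : ℝ) + 1))))
          * Real.exp (kappa163 4 / 4 / (4 * ((n : ℕ) : ℝ)) * (l1 (ctr 4 n) + (((3 + 1 : ℕ) : ℝ) * n))))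
        * Real.exp (-(kappa163 4 / 4 / (4 * ((n : ℕ) : ℝ))) * l1 (x - (n : ℤ) • y)) := by
  have h := abs_faceSymbol_G₀_legSite_le n hn 2 μ y x b
  rwa [abs_two] at h

/-- [folklore] The face generator's envelope constant is non-negative (it dominates an absolute value up to a positive exponential). -/
theorem faceGenConst_nonneg (hn : 1 ≤ n) :
    0 ≤ (((((n : ℕ) : ℝ) ^ 4)⁻¹ * ((MG163 4 * periodConst (kappa163 4) 3) * (1 + 8 * (1 + Real.exp (kappa163 4 / 4))) * Real.exp (kappa163 4 / 4)))
          * (2 * ((((3 : ℕ) : ℝ) + 1) * ((n : ℝ) * (((3 : ℕ) : ℝ) + 1))))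
          * Real.exp (kappa163 4 / 4 / (4 * ((n : ℕ) : ℝ)) * (l1 (ctr 4 n) + (((3 + 1 : ℕ) : ℝ) * n)))) := by
  have h := (abs_nonneg _).trans (abs_faceGen_G₀_legSite_le n hn 0 0 0 (Sum.inl 0))
  exact (mul_nonneg_iff_of_pos_right (Real.exp_pos _)).1 h

/-! ## §2 The (ms) bracket word against any bounded leg — the vertex mass a BINDER -/

/-- **THE (ms) BRACKET WORD IN MASS CURRENCY, ANY BOUNDED LEG, ANY VERTEX-MASS LETTER** [our objects + folklore] (modulo `Bdd G S`, `0 ≤ S`; rate `0 < σ ≤ r_G = κ₁₆₃(4)∕4∕(4n)`;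
BINDER `hV`: the `σ`-weighted `ℓ¹` mass about `n•y'` of the vertex family `V ν y' := vertexOfM K₀ n (symHessFFAt ρ_c n) ν y'` is `≤ MV` — TT27a's `hVA ∕ hVE` socket exposed at the record, taken BY
TERM by TT27b's `wmass_vertexOfM_K₀_symHessFFAt_le` (g61's `Zl`-route letter; the instance below) or by gan24-leaf-05 g63's «H-TABLE-MASS» `SymHessTablePairMass` letter (no `Zl²`)): for every
scalar `c` and directions `(a, e)`, with `Θ′ μ y := diagK (x b ↦ Σ_α Σ_{x′} colH G₀ n μ y α x′·(2·faceWt (ctrOff 4 n) n α x′))` (`G₀ = coDressKBmAt ρ_c n K₀`; the vertex read at `G₀` AS THE HEAD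
WRITES IT — leaf-01 `vertexOfM_coDress_eq`), `Decay510 (z ↦ c·tadpole G ((Θ′ e z∘V a 0 − V a 0∘Θ′ e z) + (Θ′ a 0∘V e z − V e z∘Θ′ a 0))) (|c|·(S·(2·GΘ·MV + 2·GΘ·MV))) (n·σ)` — TT27a
`decay510_bracketWord_of_wmass` over §1. -/
theorem decay510_row_ms_bracket_mass_of_wmass (hn : 1 ≤ n) {G : MKer 4 (Fib 3)} {S : ℝ} (hG : Bdd G S) (hS : 0 ≤ S)
    {σ MV : ℝ} (hσ : 0 < σ) (hσr : σ ≤ kappa163 4 / 4 / (4 * ((n : ℕ) : ℝ)))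
    (hV : ∀ (ν : Fin (3 + 1)) (y' : Site 4), (Summable fun pr : Site 4 × Site 4 =>
        (∑ a : Fib 3, ∑ b : Fib 3, |vertexOfM (KInvStep (d := 3) n 0) n (symHessFFAt (ctr 4 n) n) ν y' pr.1 pr.2 a b|)
          * Real.exp (σ * (l1 (pr.1 - (n : ℤ) • y') + l1 (pr.2 - (n : ℤ) • y')))) ∧
      ∑' pr : Site 4 × Site 4,
          (∑ a : Fib 3, ∑ b : Fib 3, |vertexOfM (KInvStep (d := 3) n 0) n (symHessFFAt (ctr 4 n) n) ν y' pr.1 pr.2 a b|)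
            * Real.exp (σ * (l1 (pr.1 - (n : ℤ) • y') + l1 (pr.2 - (n : ℤ) • y'))) ≤ MV)
    (c : ℝ) (a e : Fin (3 + 1)) :
    Decay510 (fun z : Site 4 => c * tadpole G
        ((comp (diagK fun x b => ∑ α : Fin (3 + 1), ∑ x' ∈ blockSitesF n (blk n (legSite (ctr 4 n) x b)),
                  colH (coDressKBmAt (ctr 4 n) n (KInvStep (d := 3) n 0)) n e z α x' * (2 * faceWt (ctrOff 4 n) n α x'))
              (vertexOfM (coDressKBmAt (ctr 4 n) n (KInvStep (d := 3) n 0)) n (symHessFFAt (ctr 4 n) n) a 0)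
            - comp (vertexOfM (coDressKBmAt (ctr 4 n) n (KInvStep (d := 3) n 0)) n (symHessFFAt (ctr 4 n) n) a 0)
              (diagK fun x b => ∑ α : Fin (3 + 1), ∑ x' ∈ blockSitesF n (blk n (legSite (ctr 4 n) x b)),
                  colH (coDressKBmAt (ctr 4 n) n (KInvStep (d := 3) n 0)) n e z α x' * (2 * faceWt (ctrOff 4 n) n α x')))
          + (comp (diagK fun x b => ∑ α : Fin (3 + 1), ∑ x' ∈ blockSitesF n (blk n (legSite (ctr 4 n) x b)),
                  colH (coDressKBmAt (ctr 4 n) n (KInvStep (d := 3) n 0)) n a 0 α x' * (2 * faceWt (ctrOff 4 n) n α x'))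
              (vertexOfM (coDressKBmAt (ctr 4 n) n (KInvStep (d := 3) n 0)) n (symHessFFAt (ctr 4 n) n) e z)
            - comp (vertexOfM (coDressKBmAt (ctr 4 n) n (KInvStep (d := 3) n 0)) n (symHessFFAt (ctr 4 n) n) e z)
              (diagK fun x b => ∑ α : Fin (3 + 1), ∑ x' ∈ blockSitesF n (blk n (legSite (ctr 4 n) x b)),
                  colH (coDressKBmAt (ctr 4 n) n (KInvStep (d := 3) n 0)) n a 0 α x' * (2 * faceWt (ctrOff 4 n) n α x')))))
      (|c| * (S * (2 * (((((n : ℕ) : ℝ) ^ 4)⁻¹ * ((MG163 4 * periodConst (kappa163 4) 3) * (1 + 8 * (1 + Real.exp (kappa163 4 / 4))) * Real.exp (kappa163 4 / 4)))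
                * (2 * ((((3 : ℕ) : ℝ) + 1) * ((n : ℝ) * (((3 : ℕ) : ℝ) + 1))))
                * Real.exp (kappa163 4 / 4 / (4 * ((n : ℕ) : ℝ)) * (l1 (ctr 4 n) + (((3 + 1 : ℕ) : ℝ) * n)))) * MV
          + 2 * (((((n : ℕ) : ℝ) ^ 4)⁻¹ * ((MG163 4 * periodConst (kappa163 4) 3) * (1 + 8 * (1 + Real.exp (kappa163 4 / 4))) * Real.exp (kappa163 4 / 4)))
                * (2 * ((((3 : ℕ) : ℝ) + 1) * ((n : ℝ) * (((3 : ℕ) : ℝ) + 1))))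
                * Real.exp (kappa163 4 / 4 / (4 * ((n : ℕ) : ℝ)) * (l1 (ctr 4 n) + (((3 + 1 : ℕ) : ℝ) * n)))) * MV))) ((n : ℝ) * σ) := by
  set GT : ℝ := ((((n : ℕ) : ℝ) ^ 4)⁻¹ * ((MG163 4 * periodConst (kappa163 4) 3) * (1 + 8 * (1 + Real.exp (kappa163 4 / 4))) * Real.exp (kappa163 4 / 4)))
      * (2 * ((((3 : ℕ) : ℝ) + 1) * ((n : ℝ) * (((3 : ℕ) : ℝ) + 1))))
      * Real.exp (kappa163 4 / 4 / (4 * ((n : ℕ) : ℝ)) * (l1 (ctr 4 n) + (((3 + 1 : ℕ) : ℝ) * n))) with hGT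
  have hGT0 : 0 ≤ GT := by rw [hGT]; exact faceGenConst_nonneg n hn
  -- the symbol families, enveloped at the common rate `σ ≤ r_G`
  have hg : ∀ (μ : Fin (3 + 1)) (y x : Site 4) (b : Fib 3),
      |∑ α : Fin (3 + 1), ∑ x' ∈ blockSitesF n (blk n (legSite (ctr 4 n) x b)),
          colH (coDressKBmAt (ctr 4 n) n (KInvStep (d := 3) n 0)) n μ y α x' * (2 * faceWt (ctrOff 4 n) n α x')|
        ≤ GT * Real.exp (-σ * l1 (x - (n : ℤ) • y)) := by
    intro μ y x b
    refine (abs_faceGen_G₀_legSite_le n hn μ y x b).trans ?_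
    rw [← hGT]
    refine mul_le_mul_of_nonneg_left (Real.exp_le_exp.2 ?_) hGT0
    have h0 : 0 ≤ l1 (x - (n : ℤ) • y) := l1_nonneg _
    nlinarith
  -- the vertex family is read at `K₀` (the binder `hV`)
  simp only [vertexOfM_coDress_eq]
  exact decay510_bracketWord_of_wmass (d := 3) hG hS n
    (gA := fun y x b => ∑ α : Fin (3 + 1), ∑ x' ∈ blockSitesF n (blk n (legSite (ctr 4 n) x b)),
      colH (coDressKBmAt (ctr 4 n) n (KInvStep (d := 3) n 0)) n a y α x' * (2 * faceWt (ctrOff 4 n) n α x'))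
    (gE := fun y x b => ∑ α : Fin (3 + 1), ∑ x' ∈ blockSitesF n (blk n (legSite (ctr 4 n) x b)),
      colH (coDressKBmAt (ctr 4 n) n (KInvStep (d := 3) n 0)) n e y α x' * (2 * faceWt (ctrOff 4 n) n α x'))
    hGT0 hσ.le (fun y x b => hg a y x b) (fun y x b => hg e y x b)
    (VA := fun y => vertexOfM (KInvStep (d := 3) n 0) n (symHessFFAt (ctr 4 n) n) a y)
    (VE := fun y => vertexOfM (KInvStep (d := 3) n 0) n (symHessFFAt (ctr 4 n) n) e y)
    (σ := σ) (MV := MV) le_rfl (fun y => hV a y) (fun y => hV e y) c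

/-! ## §3 The HEAD's literal (ms) row at its own leg `G₀` — BINDER form, then the `Zl`-route instance -/

/-- **ROW (ms) IN MASS CURRENCY, AT THE HEAD's LITERAL, ANY VERTEX-MASS LETTER** [our objects + folklore] (leg `G₀ = coDressKBmAt ρ_c n K₀` as in `ChartDefectHead`'s pin `hWms`; modulo the
DISPLAYED `Bdd G₀ S`, `0 ≤ S`, the rate `0 < σ ≤ r_G` and the vertex-mass BINDER `hV` of §2): for every `(a, e)`,
`Decay510 (z ↦ ½·tadpole G₀ (WMs[G₀] a 0 e z)) (¼·(S·(2·GΘ(n)·MV + 2·GΘ(n)·MV))) (n·σ)` — under the road's tadpole the raw (ms) word is `−½·` the bracket of §2 (TT26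
`tadpole_WMs_eq_neg_Wmix`, its sockets discharged by `spr_G0bm_ctr`, `trK_coDressKBmAt_KInvStep`, `vertexFamily_symHessFFAt`, `trK_symHessFFAt`), so the word is §2's at `c := −¼`. -/
theorem decay510_row_ms_mass_of_wmass (hn : 1 ≤ n) {S : ℝ} (hG : Bdd (coDressKBmAt (ctr 4 n) n (KInvStep (d := 3) n 0)) S) (hS : 0 ≤ S)
    {σ MV : ℝ} (hσ : 0 < σ) (hσr : σ ≤ kappa163 4 / 4 / (4 * ((n : ℕ) : ℝ)))
    (hV : ∀ (ν : Fin (3 + 1)) (y' : Site 4), (Summable fun pr : Site 4 × Site 4 =>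
        (∑ a : Fib 3, ∑ b : Fib 3, |vertexOfM (KInvStep (d := 3) n 0) n (symHessFFAt (ctr 4 n) n) ν y' pr.1 pr.2 a b|)
          * Real.exp (σ * (l1 (pr.1 - (n : ℤ) • y') + l1 (pr.2 - (n : ℤ) • y')))) ∧
      ∑' pr : Site 4 × Site 4,
          (∑ a : Fib 3, ∑ b : Fib 3, |vertexOfM (KInvStep (d := 3) n 0) n (symHessFFAt (ctr 4 n) n) ν y' pr.1 pr.2 a b|)
            * Real.exp (σ * (l1 (pr.1 - (n : ℤ) • y') + l1 (pr.2 - (n : ℤ) • y'))) ≤ MV)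
    (a e : Fin (3 + 1)) :
    Decay510 (fun z : Site 4 => (1 / 2 : ℝ) * tadpole (coDressKBmAt (ctr 4 n) n (KInvStep (d := 3) n 0))
        (((mixOfK (coDressKBmAt (ctr 4 n) n (KInvStep (d := 3) n 0)) n (fun κ u ρ w => (if blk n ((n : ℤ) • w + (ctr 4 n)) = blk n u then 2 * faceWt (ctrOff 4 n) n κ u else 0) • (symHessFFAt (ctr 4 n) n) ρ w) a 0 e z
              + mixOfK (coDressKBmAt (ctr 4 n) n (KInvStep (d := 3) n 0)) n (fun κ u ρ w => (if blk n ((n : ℤ) • w + (ctr 4 n)) = blk n u then 2 * faceWt (ctrOff 4 n) n κ u else 0) • (symHessFFAt (ctr 4 n) n) ρ w) e z a 0)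
            - (comp (diagK fun x b => ∑ α : Fin (3 + 1), ∑ x' ∈ blockSitesF n (blk n (legSite (ctr 4 n) x b)), colH (coDressKBmAt (ctr 4 n) n (KInvStep (d := 3) n 0)) n a 0 α x' * (2 * faceWt (ctrOff 4 n) n α x')) (vertexOfM (coDressKBmAt (ctr 4 n) n (KInvStep (d := 3) n 0)) n (symHessFFAt (ctr 4 n) n) e z)
              + comp (diagK fun x b => ∑ α : Fin (3 + 1), ∑ x' ∈ blockSitesF n (blk n (legSite (ctr 4 n) x b)), colH (coDressKBmAt (ctr 4 n) n (KInvStep (d := 3) n 0)) n e z α x' * (2 * faceWt (ctrOff 4 n) n α x')) (vertexOfM (coDressKBmAt (ctr 4 n) n (KInvStep (d := 3) n 0)) n (symHessFFAt (ctr 4 n) n) a 0)))))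
      ((1 / 4 : ℝ) * (S * (2 * (((((n : ℕ) : ℝ) ^ 4)⁻¹ * ((MG163 4 * periodConst (kappa163 4) 3) * (1 + 8 * (1 + Real.exp (kappa163 4 / 4))) * Real.exp (kappa163 4 / 4)))
                * (2 * ((((3 : ℕ) : ℝ) + 1) * ((n : ℝ) * (((3 : ℕ) : ℝ) + 1))))
                * Real.exp (kappa163 4 / 4 / (4 * ((n : ℕ) : ℝ)) * (l1 (ctr 4 n) + (((3 + 1 : ℕ) : ℝ) * n)))) * MV
          + 2 * (((((n : ℕ) : ℝ) ^ 4)⁻¹ * ((MG163 4 * periodConst (kappa163 4) 3) * (1 + 8 * (1 + Real.exp (kappa163 4 / 4))) * Real.exp (kappa163 4 / 4)))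
                * (2 * ((((3 : ℕ) : ℝ) + 1) * ((n : ℝ) * (((3 : ℕ) : ℝ) + 1))))
                * Real.exp (kappa163 4 / 4 / (4 * ((n : ℕ) : ℝ)) * (l1 (ctr 4 n) + (((3 + 1 : ℕ) : ℝ) * n)))) * MV))) ((n : ℝ) * σ) := by
  have hn0 : 0 < n := hn
  -- the record dischargers of TT26's sockets (the OWNER's `ChartDefectTwoPinsRest` (ii) uses the same four)
  have hG₀ : Spr (coDressKBmAt (ctr 4 n) n (KInvStep (d := 3) n 0)) := spr_G0bm_ctr (d := 3) (Lc := n)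
  have hG₀t : trK (coDressKBmAt (ctr 4 n) n (KInvStep (d := 3) n 0)) = sgnK (coDressKBmAt (ctr 4 n) n (KInvStep (d := 3) n 0)) :=
    trK_coDressKBmAt_KInvStep (d := 3) (Lc := n) (ctrOff_mem_box hn) 0
  have hHv : VertexFamily (symHessFFAt (ctr 4 n) n) n (2 * (ell (3 + 1) n : ℝ) ^ 2 * Real.exp (4 * ((3 : ℝ) + 1) * n * 1)) 1 :=
    vertexFamily_symHessFFAt (d := 3) hn (ctrOff_mem_box hn) zero_le_one
  have key : ∀ z : Site 4,
      (1 / 2 : ℝ) * tadpole (coDressKBmAt (ctr 4 n) n (KInvStep (d := 3) n 0))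
        (((mixOfK (coDressKBmAt (ctr 4 n) n (KInvStep (d := 3) n 0)) n (fun κ u ρ w => (if blk n ((n : ℤ) • w + (ctr 4 n)) = blk n u then 2 * faceWt (ctrOff 4 n) n κ u else 0) • (symHessFFAt (ctr 4 n) n) ρ w) a 0 e z
              + mixOfK (coDressKBmAt (ctr 4 n) n (KInvStep (d := 3) n 0)) n (fun κ u ρ w => (if blk n ((n : ℤ) • w + (ctr 4 n)) = blk n u then 2 * faceWt (ctrOff 4 n) n κ u else 0) • (symHessFFAt (ctr 4 n) n) ρ w) e z a 0)
            - (comp (diagK fun x b => ∑ α : Fin (3 + 1), ∑ x' ∈ blockSitesF n (blk n (legSite (ctr 4 n) x b)), colH (coDressKBmAt (ctr 4 n) n (KInvStep (d := 3) n 0)) n a 0 α x' * (2 * faceWt (ctrOff 4 n) n α x')) (vertexOfM (coDressKBmAt (ctr 4 n) n (KInvStep (d := 3) n 0)) n (symHessFFAt (ctr 4 n) n) e z)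
              + comp (diagK fun x b => ∑ α : Fin (3 + 1), ∑ x' ∈ blockSitesF n (blk n (legSite (ctr 4 n) x b)), colH (coDressKBmAt (ctr 4 n) n (KInvStep (d := 3) n 0)) n e z α x' * (2 * faceWt (ctrOff 4 n) n α x')) (vertexOfM (coDressKBmAt (ctr 4 n) n (KInvStep (d := 3) n 0)) n (symHessFFAt (ctr 4 n) n) a 0))))
      = (-(1 / 4) : ℝ) * tadpole (coDressKBmAt (ctr 4 n) n (KInvStep (d := 3) n 0))
        ((comp (diagK fun x b => ∑ α : Fin (3 + 1), ∑ x' ∈ blockSitesF n (blk n (legSite (ctr 4 n) x b)),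
                  colH (coDressKBmAt (ctr 4 n) n (KInvStep (d := 3) n 0)) n e z α x' * (2 * faceWt (ctrOff 4 n) n α x'))
              (vertexOfM (coDressKBmAt (ctr 4 n) n (KInvStep (d := 3) n 0)) n (symHessFFAt (ctr 4 n) n) a 0)
            - comp (vertexOfM (coDressKBmAt (ctr 4 n) n (KInvStep (d := 3) n 0)) n (symHessFFAt (ctr 4 n) n) a 0)
              (diagK fun x b => ∑ α : Fin (3 + 1), ∑ x' ∈ blockSitesF n (blk n (legSite (ctr 4 n) x b)),
                  colH (coDressKBmAt (ctr 4 n) n (KInvStep (d := 3) n 0)) n e z α x' * (2 * faceWt (ctrOff 4 n) n α x')))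
          + (comp (diagK fun x b => ∑ α : Fin (3 + 1), ∑ x' ∈ blockSitesF n (blk n (legSite (ctr 4 n) x b)),
                  colH (coDressKBmAt (ctr 4 n) n (KInvStep (d := 3) n 0)) n a 0 α x' * (2 * faceWt (ctrOff 4 n) n α x'))
              (vertexOfM (coDressKBmAt (ctr 4 n) n (KInvStep (d := 3) n 0)) n (symHessFFAt (ctr 4 n) n) e z)
            - comp (vertexOfM (coDressKBmAt (ctr 4 n) n (KInvStep (d := 3) n 0)) n (symHessFFAt (ctr 4 n) n) e z)
              (diagK fun x b => ∑ α : Fin (3 + 1), ∑ x' ∈ blockSitesF n (blk n (legSite (ctr 4 n) x b)),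
                  colH (coDressKBmAt (ctr 4 n) n (KInvStep (d := 3) n 0)) n a 0 α x' * (2 * faceWt (ctrOff 4 n) n α x')))) := by
    intro z
    rw [tadpole_WMs_eq_neg_Wmix hn0 hG₀ hG₀t hG₀ hHv one_pos (fun ρ w => trK_symHessFFAt (ctr 4 n) n ρ w) (ctr 4 n) (ctrOff 4 n) 2 a 0 e z]
    ring
  have h := decay510_row_ms_bracket_mass_of_wmass n hn hG hS hσ hσr hV (-(1 / 4) : ℝ) a e
  rw [show |(-(1 / 4) : ℝ)| = 1 / 4 by norm_num] at h
  intro z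
  have hz := h z
  dsimp only at hz ⊢
  rw [key z]
  exact hz

/-- **ROW (ms) IN MASS CURRENCY, AT THE HEAD's LITERAL** [our objects + folklore] (leg `G₀ = coDressKBmAt ρ_c n K₀` as in `ChartDefectHead`'s pin `hWms`; modulo the DISPLAYED `Bdd G₀ S`,
`0 ≤ S`, `hΦ`, `0 < κ₀`; g61's `Zl`-route letter `M_H(n)` as `MV`, modulo `hΦ`, `0 < κ₀`, `σ ≤ κ₀∕(16n)`, `σ ≤ δM∕2`, `0 < δM`): for every `(a, e)`,
`Decay510 (z ↦ ½·tadpole G₀ (WMs[G₀] a 0 e z)) (¼·(S·(2·GΘ(n)·M_H(n) + 2·GΘ(n)·M_H(n)))) (n·σ)` — under the road's tadpole the raw (ms) word is `−½·` the bracket of §2 (TT26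
`tadpole_WMs_eq_neg_Wmix`, its sockets discharged by `spr_G0bm_ctr`, `trK_coDressKBmAt_KInvStep`, `vertexFamily_symHessFFAt`, `trK_symHessFFAt`), so the word is §2's at `c := −¼`; `decay510_row_ms_mass_of_wmass` at TT27b's `wmass_vertexOfM_K₀_symHessFFAt_le`. -/
theorem decay510_row_ms_mass (hn : 1 ≤ n) {S : ℝ} (hG : Bdd (coDressKBmAt (ctr 4 n) n (KInvStep (d := 3) n 0)) S) (hS : 0 ≤ S)
    {CΦ κ₀ : ℝ} (hκ₀ : 0 < κ₀)
    (hΦ : ∀ (ρ ν : Fin (3 + 1)) (w : Fin (3 + 1) → ℤ),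
      |wΦ (N := n) ρ ν w| ≤ CΦ * ((n : ℝ) ^ 5)⁻¹ * ((n : ℝ) ^ 3)⁻¹ * Real.exp (-(κ₀ * supNorm w)))
    {σ δM : ℝ} (hσ : 0 < σ) (hσr : σ ≤ kappa163 4 / 4 / (4 * ((n : ℕ) : ℝ))) (hσΦ : σ ≤ κ₀ / (16 * (n : ℝ)))
    (hδM : 0 < δM) (hσM : σ ≤ δM / 2) (a e : Fin (3 + 1)) :
    Decay510 (fun z : Site 4 => (1 / 2 : ℝ) * tadpole (coDressKBmAt (ctr 4 n) n (KInvStep (d := 3) n 0))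
        (((mixOfK (coDressKBmAt (ctr 4 n) n (KInvStep (d := 3) n 0)) n (fun κ u ρ w => (if blk n ((n : ℤ) • w + (ctr 4 n)) = blk n u then 2 * faceWt (ctrOff 4 n) n κ u else 0) • (symHessFFAt (ctr 4 n) n) ρ w) a 0 e z
              + mixOfK (coDressKBmAt (ctr 4 n) n (KInvStep (d := 3) n 0)) n (fun κ u ρ w => (if blk n ((n : ℤ) • w + (ctr 4 n)) = blk n u then 2 * faceWt (ctrOff 4 n) n κ u else 0) • (symHessFFAt (ctr 4 n) n) ρ w) e z a 0)
            - (comp (diagK fun x b => ∑ α : Fin (3 + 1), ∑ x' ∈ blockSitesF n (blk n (legSite (ctr 4 n) x b)), colH (coDressKBmAt (ctr 4 n) n (KInvStep (d := 3) n 0)) n a 0 α x' * (2 * faceWt (ctrOff 4 n) n α x')) (vertexOfM (coDressKBmAt (ctr 4 n) n (KInvStep (d := 3) n 0)) n (symHessFFAt (ctr 4 n) n) e z)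
              + comp (diagK fun x b => ∑ α : Fin (3 + 1), ∑ x' ∈ blockSitesF n (blk n (legSite (ctr 4 n) x b)), colH (coDressKBmAt (ctr 4 n) n (KInvStep (d := 3) n 0)) n e z α x' * (2 * faceWt (ctrOff 4 n) n α x')) (vertexOfM (coDressKBmAt (ctr 4 n) n (KInvStep (d := 3) n 0)) n (symHessFFAt (ctr 4 n) n) a 0)))))
      ((1 / 4 : ℝ) * (S * (2 * (((((n : ℕ) : ℝ) ^ 4)⁻¹ * ((MG163 4 * periodConst (kappa163 4) 3) * (1 + 8 * (1 + Real.exp (kappa163 4 / 4))) * Real.exp (kappa163 4 / 4)))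
                * (2 * ((((3 : ℕ) : ℝ) + 1) * ((n : ℝ) * (((3 : ℕ) : ℝ) + 1))))
                * Real.exp (kappa163 4 / 4 / (4 * ((n : ℕ) : ℝ)) * (l1 (ctr 4 n) + (((3 + 1 : ℕ) : ℝ) * n))))
            * (4 * ((((n : ℝ) ^ 5)⁻¹ * ((n : ℝ) ^ 3)⁻¹) * (4 * CΦ * Real.exp κ₀ * Real.exp (κ₀ / 2) * Zl 4 (κ₀ / 8))
              * (16 * (2 * (ell (3 + 1) n : ℝ) ^ 2 * Real.exp (4 * ((3 : ℝ) + 1) * n * δM)) * Zl 4 (δM / 2) ^ 2)))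
          + 2 * (((((n : ℕ) : ℝ) ^ 4)⁻¹ * ((MG163 4 * periodConst (kappa163 4) 3) * (1 + 8 * (1 + Real.exp (kappa163 4 / 4))) * Real.exp (kappa163 4 / 4)))
                * (2 * ((((3 : ℕ) : ℝ) + 1) * ((n : ℝ) * (((3 : ℕ) : ℝ) + 1))))
                * Real.exp (kappa163 4 / 4 / (4 * ((n : ℕ) : ℝ)) * (l1 (ctr 4 n) + (((3 + 1 : ℕ) : ℝ) * n))))
            * (4 * ((((n : ℝ) ^ 5)⁻¹ * ((n : ℝ) ^ 3)⁻¹) * (4 * CΦ * Real.exp κ₀ * Real.exp (κ₀ / 2) * Zl 4 (κ₀ / 8))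
              * (16 * (2 * (ell (3 + 1) n : ℝ) ^ 2 * Real.exp (4 * ((3 : ℝ) + 1) * n * δM)) * Zl 4 (δM / 2) ^ 2))))))
      ((n : ℝ) * σ) :=
  decay510_row_ms_mass_of_wmass n hn hG hS hσ hσr (fun ν y' => wmass_vertexOfM_K₀_symHessFFAt_le n hn hκ₀ hΦ hσ hσΦ hδM hσM ν y') a e

/-- **ROW (ms) IN THE HEAD's BINDER SHAPES, ANY VERTEX-MASS LETTER** (`ChartDefectHead.abs_secondMoment_chartDefect_le_of_rows`' `hAms ∕ hBms`, the pin `hWms` LITERALLY; displayed letters as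
`decay510_row_ms_mass_of_wmass`): (i) `∀ a e, AbsMoment₂ (Wms a e)`; (ii) `|secondMoment Wms μ ν| ≤ C_ms(MV)·Σ'_x |x|₁² e^{−(n·σ)|x|₁}` — lit `absMoment₂_of_decay510` + `secondMoment_abs_le_of_decay510`. -/
theorem row_ms_mass_of_wmass (hn : 1 ≤ n) {S : ℝ} (hG : Bdd (coDressKBmAt (ctr 4 n) n (KInvStep (d := 3) n 0)) S) (hS : 0 ≤ S)
    {σ MV : ℝ} (hσ : 0 < σ) (hσr : σ ≤ kappa163 4 / 4 / (4 * ((n : ℕ) : ℝ)))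
    (hV : ∀ (ν : Fin (3 + 1)) (y' : Site 4), (Summable fun pr : Site 4 × Site 4 =>
        (∑ a : Fib 3, ∑ b : Fib 3, |vertexOfM (KInvStep (d := 3) n 0) n (symHessFFAt (ctr 4 n) n) ν y' pr.1 pr.2 a b|)
          * Real.exp (σ * (l1 (pr.1 - (n : ℤ) • y') + l1 (pr.2 - (n : ℤ) • y')))) ∧
      ∑' pr : Site 4 × Site 4,
          (∑ a : Fib 3, ∑ b : Fib 3, |vertexOfM (KInvStep (d := 3) n 0) n (symHessFFAt (ctr 4 n) n) ν y' pr.1 pr.2 a b|)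
            * Real.exp (σ * (l1 (pr.1 - (n : ℤ) • y') + l1 (pr.2 - (n : ℤ) • y'))) ≤ MV)
    (μ ν : Fin (3 + 1)) :
    (∀ a e : Fin (3 + 1), AbsMoment₂ (fun z : Site 4 => (1 / 2 : ℝ) * tadpole (coDressKBmAt (ctr 4 n) n (KInvStep (d := 3) n 0))
        (((mixOfK (coDressKBmAt (ctr 4 n) n (KInvStep (d := 3) n 0)) n (fun κ u ρ w => (if blk n ((n : ℤ) • w + (ctr 4 n)) = blk n u then 2 * faceWt (ctrOff 4 n) n κ u else 0) • (symHessFFAt (ctr 4 n) n) ρ w) a 0 e z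
              + mixOfK (coDressKBmAt (ctr 4 n) n (KInvStep (d := 3) n 0)) n (fun κ u ρ w => (if blk n ((n : ℤ) • w + (ctr 4 n)) = blk n u then 2 * faceWt (ctrOff 4 n) n κ u else 0) • (symHessFFAt (ctr 4 n) n) ρ w) e z a 0)
            - (comp (diagK fun x b => ∑ α : Fin (3 + 1), ∑ x' ∈ blockSitesF n (blk n (legSite (ctr 4 n) x b)), colH (coDressKBmAt (ctr 4 n) n (KInvStep (d := 3) n 0)) n a 0 α x' * (2 * faceWt (ctrOff 4 n) n α x')) (vertexOfM (coDressKBmAt (ctr 4 n) n (KInvStep (d := 3) n 0)) n (symHessFFAt (ctr 4 n) n) e z)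
              + comp (diagK fun x b => ∑ α : Fin (3 + 1), ∑ x' ∈ blockSitesF n (blk n (legSite (ctr 4 n) x b)), colH (coDressKBmAt (ctr 4 n) n (KInvStep (d := 3) n 0)) n e z α x' * (2 * faceWt (ctrOff 4 n) n α x')) (vertexOfM (coDressKBmAt (ctr 4 n) n (KInvStep (d := 3) n 0)) n (symHessFFAt (ctr 4 n) n) a 0)))))) ∧
      |B12Beta.secondMoment (fun (a e : Fin (3 + 1)) (z : Site 4) => (1 / 2 : ℝ) * tadpole (coDressKBmAt (ctr 4 n) n (KInvStep (d := 3) n 0))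
        (((mixOfK (coDressKBmAt (ctr 4 n) n (KInvStep (d := 3) n 0)) n (fun κ u ρ w => (if blk n ((n : ℤ) • w + (ctr 4 n)) = blk n u then 2 * faceWt (ctrOff 4 n) n κ u else 0) • (symHessFFAt (ctr 4 n) n) ρ w) a 0 e z
              + mixOfK (coDressKBmAt (ctr 4 n) n (KInvStep (d := 3) n 0)) n (fun κ u ρ w => (if blk n ((n : ℤ) • w + (ctr 4 n)) = blk n u then 2 * faceWt (ctrOff 4 n) n κ u else 0) • (symHessFFAt (ctr 4 n) n) ρ w) e z a 0)
            - (comp (diagK fun x b => ∑ α : Fin (3 + 1), ∑ x' ∈ blockSitesF n (blk n (legSite (ctr 4 n) x b)), colH (coDressKBmAt (ctr 4 n) n (KInvStep (d := 3) n 0)) n a 0 α x' * (2 * faceWt (ctrOff 4 n) n α x')) (vertexOfM (coDressKBmAt (ctr 4 n) n (KInvStep (d := 3) n 0)) n (symHessFFAt (ctr 4 n) n) e z)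
              + comp (diagK fun x b => ∑ α : Fin (3 + 1), ∑ x' ∈ blockSitesF n (blk n (legSite (ctr 4 n) x b)), colH (coDressKBmAt (ctr 4 n) n (KInvStep (d := 3) n 0)) n e z α x' * (2 * faceWt (ctrOff 4 n) n α x')) (vertexOfM (coDressKBmAt (ctr 4 n) n (KInvStep (d := 3) n 0)) n (symHessFFAt (ctr 4 n) n) a 0))))) μ ν|
        ≤ (((1 / 4 : ℝ) * (S * (2 * (((((n : ℕ) : ℝ) ^ 4)⁻¹ * ((MG163 4 * periodConst (kappa163 4) 3) * (1 + 8 * (1 + Real.exp (kappa163 4 / 4))) * Real.exp (kappa163 4 / 4)))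
                * (2 * ((((3 : ℕ) : ℝ) + 1) * ((n : ℝ) * (((3 : ℕ) : ℝ) + 1))))
                * Real.exp (kappa163 4 / 4 / (4 * ((n : ℕ) : ℝ)) * (l1 (ctr 4 n) + (((3 + 1 : ℕ) : ℝ) * n)))) * MV
          + 2 * (((((n : ℕ) : ℝ) ^ 4)⁻¹ * ((MG163 4 * periodConst (kappa163 4) 3) * (1 + 8 * (1 + Real.exp (kappa163 4 / 4))) * Real.exp (kappa163 4 / 4)))
                * (2 * ((((3 : ℕ) : ℝ) + 1) * ((n : ℝ) * (((3 : ℕ) : ℝ) + 1))))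
                * Real.exp (kappa163 4 / 4 / (4 * ((n : ℕ) : ℝ)) * (l1 (ctr 4 n) + (((3 + 1 : ℕ) : ℝ) * n)))) * MV))))
          * ∑' x : Site 4, l1 x ^ 2 * Real.exp (-((n : ℝ) * σ) * l1 x) := by
  have hrate : 0 < (n : ℝ) * σ := mul_pos (by exact_mod_cast hn) hσ
  have hd := fun a e => decay510_row_ms_mass_of_wmass n hn hG hS hσ hσr hV a e
  refine ⟨fun a e => absMoment₂_of_decay510 hrate (hd a e), ?_⟩
  exact (secondMoment_abs_le_of_decay510 (P := fun (a e : Fin (3 + 1)) (z : Site 4) => (1 / 2 : ℝ) * tadpole (coDressKBmAt (ctr 4 n) n (KInvStep (d := 3) n 0))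
        (((mixOfK (coDressKBmAt (ctr 4 n) n (KInvStep (d := 3) n 0)) n (fun κ u ρ w => (if blk n ((n : ℤ) • w + (ctr 4 n)) = blk n u then 2 * faceWt (ctrOff 4 n) n κ u else 0) • (symHessFFAt (ctr 4 n) n) ρ w) a 0 e z
              + mixOfK (coDressKBmAt (ctr 4 n) n (KInvStep (d := 3) n 0)) n (fun κ u ρ w => (if blk n ((n : ℤ) • w + (ctr 4 n)) = blk n u then 2 * faceWt (ctrOff 4 n) n κ u else 0) • (symHessFFAt (ctr 4 n) n) ρ w) e z a 0)
            - (comp (diagK fun x b => ∑ α : Fin (3 + 1), ∑ x' ∈ blockSitesF n (blk n (legSite (ctr 4 n) x b)), colH (coDressKBmAt (ctr 4 n) n (KInvStep (d := 3) n 0)) n a 0 α x' * (2 * faceWt (ctrOff 4 n) n α x')) (vertexOfM (coDressKBmAt (ctr 4 n) n (KInvStep (d := 3) n 0)) n (symHessFFAt (ctr 4 n) n) e z)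
              + comp (diagK fun x b => ∑ α : Fin (3 + 1), ∑ x' ∈ blockSitesF n (blk n (legSite (ctr 4 n) x b)), colH (coDressKBmAt (ctr 4 n) n (KInvStep (d := 3) n 0)) n e z α x' * (2 * faceWt (ctrOff 4 n) n α x')) (vertexOfM (coDressKBmAt (ctr 4 n) n (KInvStep (d := 3) n 0)) n (symHessFFAt (ctr 4 n) n) a 0))))) hrate (hd μ ν)).2

/-- **ROW (ms) IN THE HEAD's BINDER SHAPES** (`ChartDefectHead.abs_secondMoment_chartDefect_le_of_rows`' `hAms ∕ hBms`, the pin `hWms` LITERALLY; same displayed letters as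
`decay510_row_ms_mass`): (i) `∀ a e, AbsMoment₂ (Wms a e)`; (ii) `|secondMoment Wms μ ν| ≤ C_ms·Σ'_x |x|₁² e^{−(n·σ)|x|₁}` — lit `absMoment₂_of_decay510` +
`secondMoment_abs_le_of_decay510`.  The `n`-laws of `S` and `CΦ` are NOT claimed. -/
theorem row_ms_mass (hn : 1 ≤ n) {S : ℝ} (hG : Bdd (coDressKBmAt (ctr 4 n) n (KInvStep (d := 3) n 0)) S) (hS : 0 ≤ S)
    {CΦ κ₀ : ℝ} (hκ₀ : 0 < κ₀)
    (hΦ : ∀ (ρ ν : Fin (3 + 1)) (w : Fin (3 + 1) → ℤ),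
      |wΦ (N := n) ρ ν w| ≤ CΦ * ((n : ℝ) ^ 5)⁻¹ * ((n : ℝ) ^ 3)⁻¹ * Real.exp (-(κ₀ * supNorm w)))
    {σ δM : ℝ} (hσ : 0 < σ) (hσr : σ ≤ kappa163 4 / 4 / (4 * ((n : ℕ) : ℝ))) (hσΦ : σ ≤ κ₀ / (16 * (n : ℝ)))
    (hδM : 0 < δM) (hσM : σ ≤ δM / 2) (μ ν : Fin (3 + 1)) :
    (∀ a e : Fin (3 + 1), AbsMoment₂ (fun z : Site 4 => (1 / 2 : ℝ) * tadpole (coDressKBmAt (ctr 4 n) n (KInvStep (d := 3) n 0))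
        (((mixOfK (coDressKBmAt (ctr 4 n) n (KInvStep (d := 3) n 0)) n (fun κ u ρ w => (if blk n ((n : ℤ) • w + (ctr 4 n)) = blk n u then 2 * faceWt (ctrOff 4 n) n κ u else 0) • (symHessFFAt (ctr 4 n) n) ρ w) a 0 e z
              + mixOfK (coDressKBmAt (ctr 4 n) n (KInvStep (d := 3) n 0)) n (fun κ u ρ w => (if blk n ((n : ℤ) • w + (ctr 4 n)) = blk n u then 2 * faceWt (ctrOff 4 n) n κ u else 0) • (symHessFFAt (ctr 4 n) n) ρ w) e z a 0)
            - (comp (diagK fun x b => ∑ α : Fin (3 + 1), ∑ x' ∈ blockSitesF n (blk n (legSite (ctr 4 n) x b)), colH (coDressKBmAt (ctr 4 n) n (KInvStep (d := 3) n 0)) n a 0 α x' * (2 * faceWt (ctrOff 4 n) n α x')) (vertexOfM (coDressKBmAt (ctr 4 n) n (KInvStep (d := 3) n 0)) n (symHessFFAt (ctr 4 n) n) e z)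
              + comp (diagK fun x b => ∑ α : Fin (3 + 1), ∑ x' ∈ blockSitesF n (blk n (legSite (ctr 4 n) x b)), colH (coDressKBmAt (ctr 4 n) n (KInvStep (d := 3) n 0)) n e z α x' * (2 * faceWt (ctrOff 4 n) n α x')) (vertexOfM (coDressKBmAt (ctr 4 n) n (KInvStep (d := 3) n 0)) n (symHessFFAt (ctr 4 n) n) a 0)))))) ∧
      |B12Beta.secondMoment (fun (a e : Fin (3 + 1)) (z : Site 4) => (1 / 2 : ℝ) * tadpole (coDressKBmAt (ctr 4 n) n (KInvStep (d := 3) n 0))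
        (((mixOfK (coDressKBmAt (ctr 4 n) n (KInvStep (d := 3) n 0)) n (fun κ u ρ w => (if blk n ((n : ℤ) • w + (ctr 4 n)) = blk n u then 2 * faceWt (ctrOff 4 n) n κ u else 0) • (symHessFFAt (ctr 4 n) n) ρ w) a 0 e z
              + mixOfK (coDressKBmAt (ctr 4 n) n (KInvStep (d := 3) n 0)) n (fun κ u ρ w => (if blk n ((n : ℤ) • w + (ctr 4 n)) = blk n u then 2 * faceWt (ctrOff 4 n) n κ u else 0) • (symHessFFAt (ctr 4 n) n) ρ w) e z a 0)
            - (comp (diagK fun x b => ∑ α : Fin (3 + 1), ∑ x' ∈ blockSitesF n (blk n (legSite (ctr 4 n) x b)), colH (coDressKBmAt (ctr 4 n) n (KInvStep (d := 3) n 0)) n a 0 α x' * (2 * faceWt (ctrOff 4 n) n α x')) (vertexOfM (coDressKBmAt (ctr 4 n) n (KInvStep (d := 3) n 0)) n (symHessFFAt (ctr 4 n) n) e z)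
              + comp (diagK fun x b => ∑ α : Fin (3 + 1), ∑ x' ∈ blockSitesF n (blk n (legSite (ctr 4 n) x b)), colH (coDressKBmAt (ctr 4 n) n (KInvStep (d := 3) n 0)) n e z α x' * (2 * faceWt (ctrOff 4 n) n α x')) (vertexOfM (coDressKBmAt (ctr 4 n) n (KInvStep (d := 3) n 0)) n (symHessFFAt (ctr 4 n) n) a 0))))) μ ν|
        ≤ (((1 / 4 : ℝ) * (S * (2 * (((((n : ℕ) : ℝ) ^ 4)⁻¹ * ((MG163 4 * periodConst (kappa163 4) 3) * (1 + 8 * (1 + Real.exp (kappa163 4 / 4))) * Real.exp (kappa163 4 / 4)))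
                * (2 * ((((3 : ℕ) : ℝ) + 1) * ((n : ℝ) * (((3 : ℕ) : ℝ) + 1))))
                * Real.exp (kappa163 4 / 4 / (4 * ((n : ℕ) : ℝ)) * (l1 (ctr 4 n) + (((3 + 1 : ℕ) : ℝ) * n))))
            * (4 * ((((n : ℝ) ^ 5)⁻¹ * ((n : ℝ) ^ 3)⁻¹) * (4 * CΦ * Real.exp κ₀ * Real.exp (κ₀ / 2) * Zl 4 (κ₀ / 8))
              * (16 * (2 * (ell (3 + 1) n : ℝ) ^ 2 * Real.exp (4 * ((3 : ℝ) + 1) * n * δM)) * Zl 4 (δM / 2) ^ 2)))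
          + 2 * (((((n : ℕ) : ℝ) ^ 4)⁻¹ * ((MG163 4 * periodConst (kappa163 4) 3) * (1 + 8 * (1 + Real.exp (kappa163 4 / 4))) * Real.exp (kappa163 4 / 4)))
                * (2 * ((((3 : ℕ) : ℝ) + 1) * ((n : ℝ) * (((3 : ℕ) : ℝ) + 1))))
                * Real.exp (kappa163 4 / 4 / (4 * ((n : ℕ) : ℝ)) * (l1 (ctr 4 n) + (((3 + 1 : ℕ) : ℝ) * n))))
            * (4 * ((((n : ℝ) ^ 5)⁻¹ * ((n : ℝ) ^ 3)⁻¹) * (4 * CΦ * Real.exp κ₀ * Real.exp (κ₀ / 2) * Zl 4 (κ₀ / 8))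
              * (16 * (2 * (ell (3 + 1) n : ℝ) ^ 2 * Real.exp (4 * ((3 : ℝ) + 1) * n * δM)) * Zl 4 (δM / 2) ^ 2)))))))
          * ∑' x : Site 4, l1 x ^ 2 * Real.exp (-((n : ℝ) * σ) * l1 x) :=
  row_ms_mass_of_wmass n hn hG hS hσ hσr (fun ν' y' => wmass_vertexOfM_K₀_symHessFFAt_le n hn hκ₀ hΦ hσ hσΦ hδM hσM ν' y') μ ν

end Record

end Summit.QuantumFields.BalabanUV.Beta.D1BFx.ChartDefectRowMsMass

end
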